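import Summits.RiemannHypothesis.RiemannHypothesis.Theorems.WeilColumnThetaPrimeTailCheb
import Literature.NumberTheory.LFunctions.SchoenfeldPsiTable
import Mathlib.Analysis.SumIntegralComparisons
import HarnessLib

/-!
# THETA certificate, tier 2 input E5: partial summation of `Σ Λ(n)F(n)` against a GENERAL DECREASING majorant under `ψ ≤ C·x` beyond `N` (RH-FREE)

Cell `rh-explicit`, WEIL column, seat weil-1 gen20 (cc-s2-1 gen22 TIER2-KERNEL-SPEC §3 / THETA-TIER2-TIMING §5, item E5). The tier-1 chain summed
the cross term of THETA-CERT-cc6 §D6 by parts against the CLOSED-FORM majorant `(log n − log N)/n^{m+1}` (`vonMangoldt_logTail_sum_le_of_ge`,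
`WeilColumnThetaPrimeTailCheb`). Tier 2 (§E5) replaces it by a decreasing STEP hull `G*` produced in the kernel, so the analytic side needs the
same Abel bound for an ARBITRARY nonnegative antitone `F` — with no differentiability:

* §1 `sum_Ioc_vonMangoldt_mul_le_discrete`: for `F : ℕ → ℝ` nonnegative and non-increasing from `a+1` on and `ψ(n) ≤ C·n` for integers `n ≥ a+1`,
  `Σ_{a<n≤b} Λ(n)F(n) ≤ C·(a·F(a+1) + Σ_{a<n≤b} F(n))` — by the invariant `S(b) + (Cb − ψ(b))F(b) ≤ C(aF(a+1) + Σ_{a<n≤b}F(n))`, induction on `b`;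
* §2 **`sum_Ioc_vonMangoldt_mul_le_of_antitoneOn`**: for `F : ℝ → ℝ` nonnegative and antitone on `[N, ∞)` (`N > 0`) and `ψ(x) ≤ C·x` on `[N, ∞)`,
  `Σ_{⌊N⌋<n≤b} Λ(n)F(n) ≤ C·(N·F(N) + ∫_N^b F)` for every natural `b ≥ N` (sharp boundary term; `AntitoneOn.sum_le_integral_Ico`);
* §3 the hypothesis-free Chebyshev form (`C = log 4 + 2 log N/√N`, `N ≥ e²`, `psi_le_cheb_linear`).

RH-FREE bookkeeping about `ψ`; nothing here bears on the truth of RH.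
-/

noncomputable section

set_option linter.dupNamespace false

open Set MeasureTheory Finset
open scoped Real ArithmeticFunction.vonMangoldt Chebyshev

namespace Summit.RiemannHypothesis.RiemannHypothesis.Theorems.WeilColumn.ThetaPrime

/-! ## §1 The discrete Abel bound -/

/-- **Discrete partial summation against `ψ ≤ C·n`.** Let `F : ℕ → ℝ` be nonnegative and non-increasing on the integers `≥ a+1`, and
`ψ(n) ≤ C·n` for every integer `n ≥ a+1` (`C ≥ 0`). Then for every `b`,
`Σ_{a<n≤b} Λ(n)F(n) ≤ C·(a·F(a+1) + Σ_{a<n≤b} F(n))`. (Invariant: `S(b) + (Cb − ψ(b))F(b) ≤ C(aF(a+1) + Σ_{a<n≤b}F(n))`.) [folklore; Abel summation] -/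
theorem sum_Ioc_vonMangoldt_mul_le_discrete {a : ℕ} {C : ℝ} {F : ℕ → ℝ} (hC : 0 ≤ C)
    (hψ : ∀ n : ℕ, a + 1 ≤ n → ψ (n : ℝ) ≤ C * n) (hF0 : ∀ n : ℕ, a + 1 ≤ n → 0 ≤ F n)
    (hF : ∀ n : ℕ, a + 1 ≤ n → F (n + 1) ≤ F n) (b : ℕ) :
    ∑ n ∈ Finset.Ioc a b, Λ n * F n ≤ C * (a * F (a + 1) + ∑ n ∈ Finset.Ioc a b, F n) := by
  rcases Nat.lt_or_ge a b with hab | hba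
  · -- the invariant, by induction from `a + 1`
    have key : ∀ b : ℕ, a + 1 ≤ b →
        ∑ n ∈ Finset.Ioc a b, Λ n * F n + (C * b - ψ (b : ℝ)) * F b ≤
          C * (a * F (a + 1) + ∑ n ∈ Finset.Ioc a b, F n) := by
      intro b hb
      induction b, hb using Nat.le_induction with
      | base =>
        have hψa : 0 ≤ ψ (a : ℝ) := Chebyshev.psi_nonneg _
        have hF1 : 0 ≤ F (a + 1) := hF0 _ le_rfl
        rw [Nat.Ioc_succ_singleton, Finset.sum_singleton, Finset.sum_singleton, Literature.NumberTheory.LFunctions.PsiChain.psi_natCast_succ]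
        push_cast
        nlinarith
      | succ b hb ih =>
        have hψb : ψ (b : ℝ) ≤ C * b := hψ b hb
        have hFb : F (b + 1) ≤ F b := hF b hb
        have hFb0 : 0 ≤ F (b + 1) := hF0 _ (Nat.le_succ_of_le hb)
        rw [Finset.sum_Ioc_succ_top (by omega : a ≤ b), Finset.sum_Ioc_succ_top (by omega : a ≤ b), Literature.NumberTheory.LFunctions.PsiChain.psi_natCast_succ]
        push_cast
        have h1 : (C * b - ψ (b : ℝ)) * F (b + 1) ≤ (C * b - ψ (b : ℝ)) * F b :=
          mul_le_mul_of_nonneg_left hFb (by linarith)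
        nlinarith
    have hb : a + 1 ≤ b := hab
    have h := key b hb
    have hextra : 0 ≤ (C * b - ψ (b : ℝ)) * F b :=
      mul_nonneg (by linarith [hψ b hb]) (hF0 b hb)
    linarith
  · -- empty range
    rw [Finset.Ioc_eq_empty (by omega), Finset.sum_empty, Finset.sum_empty, add_zero]
    exact mul_nonneg hC (mul_nonneg (Nat.cast_nonneg _) (hF0 _ le_rfl))

/-! ## §2 The integral form for an antitone majorant on `[N, ∞)` -/

/-- **E5 — PARTIAL SUMMATION AGAINST A DECREASING MAJORANT.** Let `0 < N`, `0 ≤ C`, `ψ(x) ≤ C·x` for `x ≥ N`, and `F : ℝ → ℝ` nonnegative and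
antitone on `[N, ∞)`. Then for every natural `b ≥ N`,
`Σ_{⌊N⌋ < n ≤ b} Λ(n)·F(n) ≤ C·(N·F(N) + ∫_N^b F)`.
(No smoothness of `F`: this is what the tier-2 kernel's decreasing step hull needs.) [folklore; Abel summation; TIER2-KERNEL-SPEC §3 E5] -/
theorem sum_Ioc_vonMangoldt_mul_le_of_antitoneOn {N C : ℝ} (hN : 0 < N) (hC : 0 ≤ C)
    (hψ : ∀ x : ℝ, N ≤ x → ψ x ≤ C * x) {F : ℝ → ℝ} (hF : AntitoneOn F (Set.Ici N))
    (hF0 : ∀ x : ℝ, N ≤ x → 0 ≤ F x) {b : ℕ} (hb : N ≤ b) :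
    ∑ n ∈ Finset.Ioc ⌊N⌋₊ b, Λ n * F n ≤ C * (N * F N + ∫ t in N..(b : ℝ), F t) := by
  set a : ℕ := ⌊N⌋₊ with ha
  have haN : (a : ℝ) ≤ N := Nat.floor_le hN.le
  have hNa : N < (a : ℝ) + 1 := Nat.lt_floor_add_one N
  have hge : ∀ n : ℕ, a + 1 ≤ n → N ≤ (n : ℝ) := fun n hn ↦ by
    have : (a : ℝ) + 1 ≤ n := by exact_mod_cast hn
    linarith
  -- §1 at the integers
  have hdisc := sum_Ioc_vonMangoldt_mul_le_discrete (a := a) (F := fun n : ℕ ↦ F n) hC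
    (fun n hn ↦ hψ n (hge n hn)) (fun n hn ↦ hF0 n (hge n hn))
    (fun n hn ↦ hF (hge n hn) (le_trans (hge n hn) (by push_cast; linarith)) (by push_cast; linarith)) b
  refine hdisc.trans (mul_le_mul_of_nonneg_left ?_ hC)
  -- it remains: `a·F(a+1) + Σ_{a<n≤b} F(n) ≤ N·F(N) + ∫_N^b F`
  rcases Nat.lt_or_ge a b with hab | hba
  · have hab1 : a + 1 ≤ b := hab
    have hFa1 : F ((a : ℝ) + 1) ≤ F N := hF (self_mem_Ici) (show N ≤ (a : ℝ) + 1 by linarith) hNa.le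
    have hFa10 : 0 ≤ F ((a : ℝ) + 1) := hF0 _ hNa.le
    -- split off the first term and compare the rest with the integral on `[a+1, b]`
    have hsplit : ∑ n ∈ Finset.Ioc a b, F n = F ((a : ℝ) + 1) + ∑ n ∈ Finset.Ioc (a + 1) b, F n := by
      rw [← Finset.sum_Ioc_consecutive _ (Nat.le_succ a) hab1, Nat.Ioc_succ_singleton, Finset.sum_singleton]
      push_cast; ring
    have hanti : AntitoneOn F (Set.Icc ((a + 1 : ℕ) : ℝ) b) := hF.mono fun x hx ↦ by
      simp only [Set.mem_Icc, Nat.cast_add, Nat.cast_one] at hx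
      exact le_trans hNa.le hx.1
    have hrest : ∑ n ∈ Finset.Ioc (a + 1) b, F n ≤ ∫ t in ((a + 1 : ℕ) : ℝ)..(b : ℝ), F t := by
      have h := AntitoneOn.sum_le_integral_Ico hab1 hanti
      have e : ∑ i ∈ Finset.Ico (a + 1) b, F ((i + 1 : ℕ) : ℝ) = ∑ n ∈ Finset.Ioc (a + 1) b, F n := by
        rw [Finset.sum_Ico_add' (fun i : ℕ ↦ F (i : ℝ)) (a + 1) b 1, Finset.Ico_add_one_add_one_eq_Ioc]
      rw [← e]; exact h
    -- the boundary term: `(a+1)·F(a+1) ≤ N·F(N) + ∫_N^{a+1} F`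
    have hint1 : IntervalIntegrable F volume N ((a : ℝ) + 1) :=
      (hF.mono fun x hx ↦ by
        rw [Set.uIcc_of_le hNa.le, Set.mem_Icc] at hx; exact hx.1).intervalIntegrable
    have hbd : ((a : ℝ) + 1 - N) * F ((a : ℝ) + 1) ≤ ∫ t in N..((a : ℝ) + 1), F t := by
      have h := intervalIntegral.integral_mono_on hNa.le intervalIntegrable_const hint1
        (fun x hx ↦ hF (show N ≤ x from hx.1) hNa.le hx.2)
      rwa [intervalIntegral.integral_const, smul_eq_mul] at h
    have hint2 : IntervalIntegrable F volume ((a : ℝ) + 1) b :=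
      (hF.mono fun x hx ↦ by
        rw [Set.uIcc_of_le (by exact_mod_cast hab1 : (a : ℝ) + 1 ≤ b), Set.mem_Icc] at hx
        exact le_trans hNa.le hx.1).intervalIntegrable
    have hadd : ∫ t in N..(b : ℝ), F t = (∫ t in N..((a : ℝ) + 1), F t) + ∫ t in ((a : ℝ) + 1)..(b : ℝ), F t :=
      (intervalIntegral.integral_add_adjacent_intervals hint1 hint2).symm
    have hcast : ∫ t in ((a + 1 : ℕ) : ℝ)..(b : ℝ), F t = ∫ t in ((a : ℝ) + 1)..(b : ℝ), F t := by push_cast; rfl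
    have hNF : N * F ((a : ℝ) + 1) ≤ N * F N := mul_le_mul_of_nonneg_left hFa1 hN.le
    rw [hsplit, hadd]
    rw [hcast] at hrest
    push_cast
    nlinarith
  · -- `b ≤ a`: the sum is empty and the right side is nonnegative
    have hb' : (b : ℝ) ≤ a := by exact_mod_cast hba
    have hNb : N = b := le_antisymm hb (le_trans hb' haN)
    rw [Finset.Ioc_eq_empty (by omega), Finset.sum_empty, add_zero, ← hNb, intervalIntegral.integral_same, add_zero]
    have : (a : ℝ) * F ((a : ℕ) + 1 : ℕ) ≤ N * F N := by
      push_cast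
      exact mul_le_mul haN (hF self_mem_Ici hNa.le hNa.le) (hF0 _ hNa.le) hN.le
    simpa using this

/-! ## §3 The hypothesis-free Chebyshev form -/

/-- **E5 WITHOUT ANY HYPOTHESIS ON `ψ`**: for `N ≥ e²`, `F ≥ 0` antitone on `[N, ∞)` and every natural `b ≥ N`,
`Σ_{⌊N⌋ < n ≤ b} Λ(n)F(n) ≤ (log 4 + 2 log N/√N)·(N·F(N) + ∫_N^b F)` (Mathlib's Chebyshev bound via `psi_le_cheb_linear`). [Chebyshev; E5] -/
theorem sum_Ioc_vonMangoldt_mul_le_of_antitoneOn_cheb {N : ℝ} (hN : Real.exp 2 ≤ N) {F : ℝ → ℝ}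
    (hF : AntitoneOn F (Set.Ici N)) (hF0 : ∀ x : ℝ, N ≤ x → 0 ≤ F x) {b : ℕ} (hb : N ≤ b) :
    ∑ n ∈ Finset.Ioc ⌊N⌋₊ b, Λ n * F n ≤
      (Real.log 4 + 2 * (Real.log N / Real.sqrt N)) * (N * F N + ∫ t in N..(b : ℝ), F t) :=
  sum_Ioc_vonMangoldt_mul_le_of_antitoneOn ((Real.exp_pos 2).trans_le hN) (cheb_const_nonneg hN)
    (fun _ hx ↦ psi_le_cheb_linear hN hx) hF hF0 hb

/-! ## §4 Uniform partial-sum bounds with the improper integral (the form a `∀ K`-consumer uses) -/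

/-- **E5, uniform in the cut-off**: if moreover `F` is integrable on `(N, ∞)`, then for EVERY natural `b`,
`Σ_{⌊N⌋ < n ≤ b} Λ(n)F(n) ≤ C·(N·F(N) + ∫_{(N,∞)} F)`. [folklore; Abel summation; TIER2-KERNEL-SPEC §3 E5] -/
theorem sum_Ioc_vonMangoldt_mul_le_of_antitoneOn_of_integrableOn {N C : ℝ} (hN : 0 < N) (hC : 0 ≤ C)
    (hψ : ∀ x : ℝ, N ≤ x → ψ x ≤ C * x) {F : ℝ → ℝ} (hF : AntitoneOn F (Set.Ici N))
    (hF0 : ∀ x : ℝ, N ≤ x → 0 ≤ F x) (hint : IntegrableOn F (Set.Ioi N)) (b : ℕ) :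
    ∑ n ∈ Finset.Ioc ⌊N⌋₊ b, Λ n * F n ≤ C * (N * F N + ∫ t in Set.Ioi N, F t) := by
  have hI0 : 0 ≤ ∫ t in Set.Ioi N, F t :=
    setIntegral_nonneg measurableSet_Ioi fun x hx ↦ hF0 x (le_of_lt hx)
  rcases lt_or_ge (b : ℝ) N with hbN | hNb
  · -- `b < N`: empty sum
    have hb : b ≤ ⌊N⌋₊ := Nat.le_floor hbN.le
    rw [Finset.Ioc_eq_empty (by omega), Finset.sum_empty]
    exact mul_nonneg hC (add_nonneg (mul_nonneg hN.le (hF0 N le_rfl)) hI0)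
  · refine (sum_Ioc_vonMangoldt_mul_le_of_antitoneOn hN hC hψ hF hF0 hNb).trans
      (mul_le_mul_of_nonneg_left ?_ hC)
    have hsub : ∫ t in N..(b : ℝ), F t ≤ ∫ t in Set.Ioi N, F t := by
      rw [intervalIntegral.integral_of_le hNb]
      refine setIntegral_mono_set hint ?_ (ae_of_all _ fun x (hx : x ∈ Set.Ioc N (b : ℝ)) ↦ (hx.1 : x ∈ Set.Ioi N))
      exact ae_restrict_of_forall_mem measurableSet_Ioi fun x hx ↦ hF0 x (le_of_lt hx)
    linarith

end Summit.RiemannHypothesis.RiemannHypothesis.Theorems.WeilColumn.ThetaPrime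

end
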